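import Literature.AlgebraicGeometry.Morphisms.FormalImmersionSections
import HarnessLib

/-!
# The notion "formal immersion at a point" (Mazur 1978, §3)

Topic `Literature/AlgebraicGeometry/Morphisms`. DEFINITION requested by the formalization of
B. Mazur, *Rational isogenies of prime degree*, Invent. Math. 44 (1978): §3 p. 142, "If `f : X → Y`
is a morphism of finite type between noetherian schemes, we shall say that `f` is a *formal
immersion at a point `x`* if the induced map on the completions of local rings
`𝒪̂_{Y,f(x)} → 𝒪̂_{X,x}` is surjective"; Prop. 3.1 (`X₀(N)^smooth → J̃` is a formal immersion along
`∞` away from characteristic `2`) and Cor. 4.3 are stated in these terms. The predicate packages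
the hypothesis used throughout `FormalImmersionSections.lean` (level-wise surjectivity of
`𝒪_{Y,f(x)} → 𝒪_{X,x}/𝔪_xᵏ`, which for the local homomorphism of local rings `f^#_x` is
equivalent to the surjectivity of the map of completed local rings,
`Literature.RingTheory.CompleteLocalRings.surjective_completionMap_iff_of_isLocalHom`), with its
API restated: `isFormalImmersionAt_iff`, `IsFormalImmersionAt.of_cotangent` /
`isFormalImmersionAt_iff_cotangent` (EGA IV 17.4.4), `IsFormalImmersionAt.hom_ext` (rigidity of
sections, Mazur p. 145).

## References

* [Mazur1978] B. Mazur, *Rational isogenies of prime degree*, Invent. Math. 44 (1978), §3 p. 142,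
  Prop. 3.1, proof of Cor. 4.3 (p. 145).
* [Grothendieck1967] EGA IV₄, 17.4.4.
-/

noncomputable section

open CategoryTheory AlgebraicGeometry IsLocalRing

namespace Literature.AlgebraicGeometry.Morphisms

universe u

variable {X Y : Scheme.{u}}

/-- **Formal immersion at a point** (Mazur 1978, §3 p. 142). A morphism of schemes `f : X ⟶ Y`
is a *formal immersion at `x ∈ X`* if for every `k` the composite
`𝒪_{Y,f(x)} → 𝒪_{X,x} → 𝒪_{X,x}/𝔪_xᵏ` of the stalk map with the reduction modulo `𝔪_xᵏ` is
surjective — equivalently (`surjective_completionMap_iff_of_isLocalHom`) the map of completed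
local rings `𝒪̂_{Y,f(x)} → 𝒪̂_{X,x}` is surjective, which is Mazur's wording; equivalently
(`isFormalImmersionAt_iff_cotangent`, EGA IV 17.4.4) `k(f(x)) → k(x)` and the cotangent map are
onto. [cite: Mazur1978, §3 p. 142] -/
@[mk_iff]
structure IsFormalImmersionAt (f : X ⟶ Y) (x : X) : Prop where
  /-- `𝒪_{Y,f(x)} → 𝒪_{X,x}/𝔪_xᵏ` is onto for every `k`. -/
  surjective_mk_pow_comp_stalkMap : ∀ k : ℕ, Function.Surjective
    ((Ideal.Quotient.mk (maximalIdeal (X.presheaf.stalk x) ^ k)).comp (f.stalkMap x).hom)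

variable {f : X ⟶ Y} {x : X}

/-- **Cotangent criterion (EGA IV 17.4.4).** If `f^#_x` is onto on residue fields and on
cotangent spaces (`𝔪_x ≤ f^#(𝔪_{f(x)})𝒪_{X,x} + 𝔪_x²`) then `f` is a formal immersion at `x` —
the form in which Mazur 1978, Prop. 3.1 is proved. [cite: Mazur1978, §3 p. 142 (EGA IV 17.4.4)] -/
theorem IsFormalImmersionAt.of_cotangent
    (hres : Function.Surjective (ResidueField.map (f.stalkMap x).hom))
    (hcot : maximalIdeal (X.presheaf.stalk x) ≤
      (maximalIdeal (Y.presheaf.stalk (f.base x))).map (f.stalkMap x).hom ⊔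
        maximalIdeal (X.presheaf.stalk x) ^ 2) :
    IsFormalImmersionAt f x :=
  ⟨forall_surjective_of_cotangent hres hcot⟩

/-- **EGA IV 17.4.4, cotangent form**: `f` is a formal immersion at `x` iff `f^#_x` is onto on
residue fields and on cotangent spaces. [cite: Mazur1978, §3 p. 142 (EGA IV 17.4.4)] -/
theorem isFormalImmersionAt_iff_cotangent :
    IsFormalImmersionAt f x ↔
      Function.Surjective (ResidueField.map (f.stalkMap x).hom) ∧
        maximalIdeal (X.presheaf.stalk x) ≤
          (maximalIdeal (Y.presheaf.stalk (f.base x))).map (f.stalkMap x).hom ⊔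
            maximalIdeal (X.presheaf.stalk x) ^ 2 := by
  rw [isFormalImmersionAt_iff]
  exact forall_surjective_iff_cotangent

/-- **Rigidity of sections** (Mazur 1978, proof of Cor. 4.3, p. 145). If `f` is a formal
immersion at `x`, `R` is a noetherian local ring and `s, t : Spec R ⟶ X` send the closed point
to `x` and satisfy `s ≫ f = t ≫ f`, then `s = t`. [cite: Mazur1978, proof of Cor. 4.3, p. 145] -/
theorem IsFormalImmersionAt.hom_ext (H : IsFormalImmersionAt f x) {R : CommRingCat.{u}}
    [IsLocalRing R] [IsNoetherianRing R] {s t : Spec R ⟶ X}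
    (hs : s.base (closedPoint R) = x) (ht : t.base (closedPoint R) = x) (hst : s ≫ f = t ≫ f) :
    s = t :=
  hom_ext_of_forall_surjective H.surjective_mk_pow_comp_stalkMap hs ht hst

/-- Rigidity at the level of stalks: for a formal immersion at `x`, two local homomorphisms
`𝒪_{X,x} → R` into a noetherian local ring agreeing on `𝒪_{Y,f(x)}` are equal.
[cite: Mazur1978, proof of Cor. 4.3, p. 145] -/
theorem IsFormalImmersionAt.stalk_hom_ext (H : IsFormalImmersionAt f x) {R : CommRingCat.{u}}
    [IsLocalRing R] [IsNoetherianRing R] {σ τ : X.presheaf.stalk x ⟶ R} [IsLocalHom σ.hom]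
    [IsLocalHom τ.hom] (h : f.stalkMap x ≫ σ = f.stalkMap x ≫ τ) : σ = τ :=
  stalk_hom_ext_of_forall_surjective H.surjective_mk_pow_comp_stalkMap h

end Literature.AlgebraicGeometry.Morphisms
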